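import Literature.AlgebraicGeometry.ShimuraVarieties.UnitaryShimuraCurveLevelQuotient
import Literature.AlgebraicGeometry.Motives.SepQuotientIntermediateFibres
import Literature.NumberTheory.Automorphic.Liu2021.AppendixC.RestOneLevelInvariants
import Literature.NumberTheory.Automorphic.Liu2021.AppendixC.SmallLevelTrace
import HarnessLib

/-!
# HECKE-PRESENTATION FROM ONE LIFT PER POINT on the record of the unitary Shimura curve, over an ABSTRACT family of Hecke
# translates: the `t₁`∕`t₂`-translate clause at every presentation from the clause at ONE chosen lift per point of a NORMAL reference
# level (Deligne 1979 2.7.1 (c); SGA 1 V Prop. 1.1; Milne 2005 §5 ∕ Thm. 13.6)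

Topic `AlgebraicGeometry/ShimuraVarieties`; namespace `Literature.AlgebraicGeometry.ShimuraVarieties.UnitaryCanonicalModel` (dotted
`RecordSystemGS.*` names).  PROOF FILE (theorems only: no definition, no instance, no notation, no named fact, no `sorry`) over ★
`UnitaryShimuraCurveRecordMorphisms` (the predicate `RecordSystemGS.IsHeckeTranslate` and its GS-2b laws `isHeckeTranslate_comp` ∕
`isHeckeTranslate_id_of_mem` ∕ `isHeckeTranslate_one_map` ∕ `heckeTranslate_unique`), ★ `UnitaryShimuraCurveLevelQuotient` (`RecordSystemGS.IsLevelQuotient`: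
the levels are quotients of one another, [Deligne1979ShimuraVarieties] 2.7.1 (c)), ★ `Motives/SepQuotientIntermediateFibres` (geometric fibres of a separated
quotient are orbits ∕ the quotient is onto on geometric points, finite-index form, [SGA1] V Prop. 1.1), ★ `AppendixC/RestOneLevelInvariants` and ★
`AppendixC/SmallLevelTrace` (small-level bookkeeping).

WHY THIS FILE (and why over an abstract family).  ★ `Liu2021/AppendixC/RecordHeckePresentation` proves `hecke_of_hecke_at_level` — the (c1) `hecke`
clause of the P6 moduli datum at EVERY presentation `(N′, rc₁, rc₂, x′)` from the clause at ONE reference level `N₀`, required there at EVERY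
`x₀ ∈ M⋆_{N₀}(Ω)` — in the currency of the record՚s CHOSEN translates `recordHeckeTranslateGS S hU7ₛ` of ★ `RecordCurveSec42Datum`.  Two things are
missing for the consumer (cell `hodgecm-mathlib`, programme P6 «MOD», half A line L1, socket `stub_LINES` of `Cruxes/HLiu418/Lines/F0_P6a_DatumOfInputs.lean`
ED. 1 :498, organ `stub_OLIFT`; `--supports` stmt-HodgeConjecture-24832): (i) whoever CONSTRUCTS the readings `quotΩ y`, `translΩ y` does so from ONE chosen
lift `x₀(y) ∈ M⋆_{N₀}(Ω)` of each `y`, so `h₀` must be weakened to «every `y` has SOME lift at which the clause holds» — true when `N₀` is normalised by `Kc`,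
because the geometric fibres of `M⋆_{N₀} → M⋆_{Kc}` are then single `Kc`-orbits; (ii) the consumer՚s line file sees a COPY of `recordHeckeTranslateGS`
declared inside its own import cone (crux workfile `Lines/D6CmCurveBody.lean`), so it cannot import ★ `RecordCurveSec42Datum` or anything above it.  Hence
this file is stated over an ABSTRACT TRANSLATE FAMILY `T r N′ h : M⋆_{N′} ⟶ M⋆_{Kc}` with `hT : S.IsHeckeTranslate N′ Kc r (T r N′ h)` and over
`hLQ : S.IsLevelQuotient` (★ `RecordSystemGS.isLevelQuotient_of_heckeTranslateDefinedOver S hU7ₛ` supplies it), imports only modules below that copy, and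
re-derives the two short ★ steps it needs in that currency (§0 ⊇ ★ `exists_algPoints_map_eq_of_normal`, here for ANY `N′ ≤ N`; §1 = ★
`map_recordHeckeTranslateGS_eq_of_coset_eq` over abstract translates; both three-line consequences of the GS-2b laws).  Instantiating `T := fun r N′ h => recordHeckeTranslateGS S hU7ₛ r N′ Kc h` (either copy)
recovers the chosen-translate statements by `β`-reduction.  HONEST LABEL: HC_CM is proved only modulo the 2 remaining named inputs (hLiu418 24832,
h413 24833) until rung 0 closes; this file is count-neutral capital (record side only: no moduli, no integral model; `Line`, `quotΩ`, `translΩ` abstract;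
`t₁ t₂` arbitrary).

THE ARGUMENT ([Deligne1979ShimuraVarieties] 2.7.1 (c) «`(K/L)\S_L ⥲ S_K`»; [SGA1] Exp. V Prop. 1.1 «les fibres géométriques sont les orbites»;
[Milne2005ShimuraVarieties] §5 p. 58 «`T(gh) = T(h) ∘ T(g)`», Rem. 5.29 (c), Thm. 13.6).  Let `N₀ ≤ Kc` be small levels with `k⁻¹N₀k ⊆ N₀` for `k ∈ Kc`.
(§2) Two lifts `x₀, x₀′ ∈ M⋆_{N₀}(Ω)` of one `y ∈ M⋆_{Kc}(Ω)` differ by a translate: `Kc` acts on `M⋆_{N₀}` by `act k = T_{k⁻¹}` and `u : M⋆_{N₀} → M⋆_{Kc}` is the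
quotient for separated test objects (`hLQ`), so `x₀′ = (act k) x₀` for some `k ∈ Kc` (★ `IsSepQuotient.exists_map_act_eq_of_map_eq_geometric_of_finiteIndex`,
`M⋆_{N₀}` projective, `N₀` of finite index in `Kc` acting trivially).  (§1) A translate `T₀ : M⋆_{N₀} → M⋆_{N₀}` by `g` followed by a translate `M⋆_{N₀} → M⋆_{Kc}`
by `r` is a translate by `g r`, hence equals any translate by a representative `r′` of the coset `g r Kc` (both are translates by elements of one `Kc`-coset,
`Kc` acting trivially on `M⋆_{Kc}`; GS-2b uniqueness).  (§3) So `T_{rd₁ β} x₀′ = T_{rd₁ (k⁻¹•β)} x₀`, `T_{rd₂ β₂} x₀′ = T_{rd₂ (k⁻¹•β₂)} x₀`, and the clause at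
`x₀` with bijection `e` gives the clause at `x₀′` with `e′ := e ∘ (k⁻¹ • ·)`.  (§4) Given any presentation `(N′, rc₁, rc₂, x′)` of `y`: a level `N″ ≤ N′ ⊓ N₀`
(★ `C5.SmallLevel.exists_le_le`), a lift `x″ ∈ M⋆_{N″}(Ω)` of `x′` (§0), `x₀′ := u_{N″→N₀} x″` over `y`; `rc₁ β Kc = β =
rd₁ β Kc` gives `T_{rc₁ β} x′ = T_{rd₁ β} x₀′` (§1 on the common lift `x″`), and §3 moves the clause from the chosen lift `x₀(y)` to `x₀′`.

* §0 `RecordSystemGS.exists_algPoints_map_eq_of_isLevelQuotient` — lift of a geometric point along ANY level map `M⋆_{N′} → M⋆_N`, `N′ ≤ N` (no normality).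
* §1 `RecordSystemGS.comp_eq_of_isHeckeTranslate_of_coset_eq` ∕ `…map_map_eq_of_isHeckeTranslate_of_coset_eq` ∕
  `…map_map_eq_map_map_of_isHeckeTranslate_of_coset_eq` — translates by representatives of one `Kc`-coset agree (after a source translate ∕ on a common
  deeper level).
* §2 `RecordSystemGS.exists_isHeckeTranslate_map_eq_of_map_eq` — FIBRE TRANSITIVITY: two lifts of `y` at a normal level differ by a translate `T_{k⁻¹}`, `k ∈ Kc`.
* §3 `RecordSystemGS.hecke_at_lift_of_hecke_at_lift` — LIFT-INDEPENDENCE of the clause at a normal level.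
* §4 **`RecordSystemGS.hecke_of_hecke_at_chosen_lifts`** — the head; conclusion = the `hecke` field type of `ModuliDatum` ∕ `PointDictionary` ∕ the D-line
  letter `HeckeClause` with `N′ hN′Kc rc₁ _ hrcN₁ rc₂ _ hrcN₂ x′` as binders, spelled with `T (rc₁ β) N′ (hrcN₁ β)`.

## References
* [Deligne1979ShimuraVarieties] P. Deligne, *Variétés de Shimura*, PSPM XXXIII.2 (1979), 2.1.2–2.1.4, 2.7.1 (b)–(c).
* [SGA1] A. Grothendieck, *Revêtements étales et groupe fondamental*, Exp. V §1 Prop. 1.1.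
* [Milne2005ShimuraVarieties] J. S. Milne, *Introduction to Shimura varieties* (2005), §5 p. 57 L7–12, p. 58 L3–11, Rem. 5.29 (c) p. 65, Thm. 13.6 p. 118.
* [MumfordAV1970] D. Mumford, *Abelian Varieties* (1970), §7 Thm. p. 66 (Remark).
* [Liu2021] Y. Liu, *Fourier–Jacobi cycles and arithmetic relative trace formula*, Camb. J. Math. 9 (2021), §4.2 l. 2060–2074, Prop. D.8 (1) p. 135.
-/

set_option autoImplicit false

open CategoryTheory _root_.NumberField _root_.IsDedekindDomain _root_.MulAction _root_.AlgebraicGeometry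
open Literature.AlgebraicGeometry.Motives
open Literature.NumberTheory.Automorphic Literature.NumberTheory.Automorphic.UnitaryGroup
open Literature.NumberTheory.Automorphic.Liu2021.AppendixC

namespace Literature.AlgebraicGeometry.ShimuraVarieties.UnitaryCanonicalModel

variable {F : Type} [Field F] [NumberField F] [IsCMField F] {Jstar : Matrix (Fin 2) (Fin 2) F} {ι₁ : F →+* ℂ}
  {K₀ : C5.OpenCompactSubgroup ↥(finAdelic ↥(maximalRealSubfield F) F (IsCMField.complexConj F) 2 Jstar)}
  (S : RecordSystemGS F Jstar ι₁ K₀)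

/-! ### §0 Lift of a geometric point along any level map -/

/-- **Every geometric point of `M⋆_N` lifts along every level map `u : M⋆_{N′} → M⋆_N` (`N′ ≤ N`)** of a level-quotient record (`hLQ`;
`Ω ⊇ F` algebraically closed) — NO normality hypothesis: through a deeper level `N″ ≤ N′` normalised by `N` (★ `C5.SmallLevel.exists_normal_le`),
`M⋆_{N″} → M⋆_N` is a quotient of the projective `M⋆_{N″}` by the finite group `N∕N″` for separated test objects, hence onto on geometric points (★
`IsSepQuotient.surjective_map_geometric_of_finiteIndex`; the normal case is ★ `AppendixC.exists_algPoints_map_eq_of_normal`), and a lift to `M⋆_{N″}`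
pushes down to `M⋆_{N′}`. [cite: SGA1, Exp. V §1 Prop. 1.1] [cite: Milne2005ShimuraVarieties, §5 p. 57 L7–12 and Rem. 5.29 (c) p. 65]
[cite: Deligne1979ShimuraVarieties, 2.7.1 (c)] -/
theorem RecordSystemGS.exists_algPoints_map_eq_of_isLevelQuotient (hLQ : S.IsLevelQuotient) {Ω : Type} [Field Ω] [Algebra F Ω]
    [IsAlgClosed Ω] {N' N : C5.SmallLevel K₀} (hN'N : N' ≤ N) (x : AlgPoints (S.M.obj N) Ω) :
    ∃ x' : AlgPoints (S.M.obj N') Ω, AlgPoints.map (S.M.map (homOfLE hN'N)) x' = x := by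
  -- a deeper level `N″ ≤ N′` normalised by `N`
  obtain ⟨N'', hN''N, hN''N', hn⟩ := C5.SmallLevel.exists_normal_le N N'
  obtain ⟨actN, hactN'⟩ := hLQ hN''N (fun k hk n hn' => hn k hk n hn')
  haveI := C5.SmallLevel.normal_subgroupOf_of_heckeLE N'' N hn
  haveI := C5.SmallLevel.finiteIndex_subgroupOf N'' N
  have hXN'' : IsProjectiveOver (S.M.obj N'') := S.projective N''
  haveI : IsProper (S.M.obj N).hom := (S.projective N).isProper
  have hker : ∀ n ∈ (N''.1.1 : Subgroup ↥(finAdelic ↥(maximalRealSubfield F) F (IsCMField.complexConj F) 2 Jstar)).subgroupOf N.1.1,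
      actN n = 1 := fun n hn' =>
    RecordSystemGS.IsLevelQuotient.act_eq_one_of_mem hactN'.1 n (Subgroup.mem_subgroupOf.1 hn')
  -- lift to `M⋆_{N″}`, push down to `M⋆_{N′}`
  obtain ⟨x'', hx''⟩ := IsSepQuotient.surjective_map_geometric_of_finiteIndex (algebraMap F Ω) actN
    ((N''.1.1 : Subgroup ↥(finAdelic ↥(maximalRealSubfield F) F (IsCMField.complexConj F) 2 Jstar)).subgroupOf N.1.1)
    (S.M.map (homOfLE hN''N)) hXN'' inferInstance hker hactN'.2 x
  refine ⟨AlgPoints.map (S.M.map (homOfLE hN''N')) x'', ?_⟩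
  rw [← AlgPoints.map_comp_apply, ← Functor.map_comp]
  exact hx''

/-! ### §1 Translates by representatives of one `Kc`-coset agree -/

/-- **`T₀ ≫ T_r = T_{r′}` when `T₀ : M⋆_{N₀} → M⋆_{N₀}` is a Hecke translate by `g`, `T_r`, `T_{r′} : M⋆_{N₀} → M⋆_{Kc}` are translates by `r`, `r′`,
and `g r Kc = r′ Kc`**: both sides are Hecke translates `M⋆_{N₀} → M⋆_{Kc}` by elements of one `Kc`-coset — `T₀ ≫ T_r` by `g r` (★ `isHeckeTranslate_comp`),
`T_{r′} = T_{r′} ≫ 𝟙` by `r′ m = g r` with `m ∈ Kc` acting trivially on `M⋆_{Kc}` (★ `isHeckeTranslate_id_of_mem`) — hence equal (GS-2b uniqueness ★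
`RecordSystemGS.heckeTranslate_unique`). [cite: Milne2005ShimuraVarieties, §5 p. 58 L6–11 and Thm. 13.6 p. 118] [cite: Deligne1979ShimuraVarieties, 2.1.4] -/
theorem RecordSystemGS.comp_eq_of_isHeckeTranslate_of_coset_eq {N₀ Kc : C5.SmallLevel K₀}
    {g r r' : ↥(finAdelic ↥(maximalRealSubfield F) F (IsCMField.complexConj F) 2 Jstar)} {T₀ : S.M.obj N₀ ⟶ S.M.obj N₀}
    {Tr Tr' : S.M.obj N₀ ⟶ S.M.obj Kc} (hT₀ : S.IsHeckeTranslate N₀ N₀ g T₀) (hr : S.IsHeckeTranslate N₀ Kc r Tr)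
    (hr' : S.IsHeckeTranslate N₀ Kc r' Tr')
    (hcoset : ((g * r : ↥(finAdelic ↥(maximalRealSubfield F) F (IsCMField.complexConj F) 2 Jstar)) :
        ↥(finAdelic ↥(maximalRealSubfield F) F (IsCMField.complexConj F) 2 Jstar) ⧸
          (Kc.1.1 : Subgroup ↥(finAdelic ↥(maximalRealSubfield F) F (IsCMField.complexConj F) 2 Jstar))) =
      ((r' : ↥(finAdelic ↥(maximalRealSubfield F) F (IsCMField.complexConj F) 2 Jstar)) :
        ↥(finAdelic ↥(maximalRealSubfield F) F (IsCMField.complexConj F) 2 Jstar) ⧸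
          (Kc.1.1 : Subgroup ↥(finAdelic ↥(maximalRealSubfield F) F (IsCMField.complexConj F) 2 Jstar)))) :
    T₀ ≫ Tr = Tr' := by
  have h₁ : S.IsHeckeTranslate N₀ Kc (g * r) (T₀ ≫ Tr) := S.isHeckeTranslate_comp hT₀ hr
  have hmem : r'⁻¹ * (g * r) ∈ Kc.1.1 := QuotientGroup.eq.1 hcoset.symm
  have h₂ : S.IsHeckeTranslate N₀ Kc (r' * (r'⁻¹ * (g * r))) (Tr' ≫ 𝟙 _) :=
    S.isHeckeTranslate_comp hr' (S.isHeckeTranslate_id_of_mem Kc hmem)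
  rw [mul_inv_cancel_left, Category.comp_id] at h₂
  exact S.heckeTranslate_unique h₁ h₂

/-- The same on `Ω`-points: `T_r (T₀ x₀) = T_{r′} x₀`. [cite: Milne2005ShimuraVarieties, §5 p. 58 L6–11 and Thm. 13.6 p. 118] -/
theorem RecordSystemGS.map_map_eq_of_isHeckeTranslate_of_coset_eq {Ω : Type} [Field Ω] [Algebra F Ω] {N₀ Kc : C5.SmallLevel K₀}
    {g r r' : ↥(finAdelic ↥(maximalRealSubfield F) F (IsCMField.complexConj F) 2 Jstar)} {T₀ : S.M.obj N₀ ⟶ S.M.obj N₀}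
    {Tr Tr' : S.M.obj N₀ ⟶ S.M.obj Kc} (hT₀ : S.IsHeckeTranslate N₀ N₀ g T₀) (hr : S.IsHeckeTranslate N₀ Kc r Tr)
    (hr' : S.IsHeckeTranslate N₀ Kc r' Tr')
    (hcoset : ((g * r : ↥(finAdelic ↥(maximalRealSubfield F) F (IsCMField.complexConj F) 2 Jstar)) :
        ↥(finAdelic ↥(maximalRealSubfield F) F (IsCMField.complexConj F) 2 Jstar) ⧸
          (Kc.1.1 : Subgroup ↥(finAdelic ↥(maximalRealSubfield F) F (IsCMField.complexConj F) 2 Jstar))) =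
      ((r' : ↥(finAdelic ↥(maximalRealSubfield F) F (IsCMField.complexConj F) 2 Jstar)) :
        ↥(finAdelic ↥(maximalRealSubfield F) F (IsCMField.complexConj F) 2 Jstar) ⧸
          (Kc.1.1 : Subgroup ↥(finAdelic ↥(maximalRealSubfield F) F (IsCMField.complexConj F) 2 Jstar))))
    (x₀ : AlgPoints (S.M.obj N₀) Ω) : AlgPoints.map Tr (AlgPoints.map T₀ x₀) = AlgPoints.map Tr' x₀ := by
  rw [← AlgPoints.map_comp_apply, S.comp_eq_of_isHeckeTranslate_of_coset_eq hT₀ hr hr' hcoset]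

/-- **Translates by two representatives of the same `Kc`-coset, from two source levels, agree on a common deeper level** (★
`AppendixC.map_recordHeckeTranslateGS_eq_of_coset_eq`, over abstract translates): for `N″ ≤ N′`, `N″ ≤ N₀`, `r Kc = r₀ Kc`, `T_r : M⋆_{N′} → M⋆_{Kc}` a
translate by `r` and `T_{r₀} : M⋆_{N₀} → M⋆_{Kc}` a translate by `r₀`, `T_r (u_{N″→N′} x″) = T_{r₀} (u_{N″→N₀} x″)` — both composites are translates
`M⋆_{N″} → M⋆_{Kc}` by elements of one `Kc`-coset (★ `isHeckeTranslate_one_map`, `isHeckeTranslate_comp`, `isHeckeTranslate_id_of_mem`,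
`heckeTranslate_unique`). [cite: Milne2005ShimuraVarieties, Thm. 13.6 p. 118] [cite: Deligne1979ShimuraVarieties, 2.1.4] -/
theorem RecordSystemGS.map_map_eq_map_map_of_isHeckeTranslate_of_coset_eq {Ω : Type} [Field Ω] [Algebra F Ω]
    {N'' N' N₀ Kc : C5.SmallLevel K₀} (h' : N'' ≤ N') (h₀ : N'' ≤ N₀)
    {r r₀ : ↥(finAdelic ↥(maximalRealSubfield F) F (IsCMField.complexConj F) 2 Jstar)}
    {Tr : S.M.obj N' ⟶ S.M.obj Kc} {Tr₀ : S.M.obj N₀ ⟶ S.M.obj Kc}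
    (hr : S.IsHeckeTranslate N' Kc r Tr) (hr₀ : S.IsHeckeTranslate N₀ Kc r₀ Tr₀)
    (hcoset : ((r : ↥(finAdelic ↥(maximalRealSubfield F) F (IsCMField.complexConj F) 2 Jstar)) :
        ↥(finAdelic ↥(maximalRealSubfield F) F (IsCMField.complexConj F) 2 Jstar) ⧸
          (Kc.1.1 : Subgroup ↥(finAdelic ↥(maximalRealSubfield F) F (IsCMField.complexConj F) 2 Jstar))) =
      ((r₀ : ↥(finAdelic ↥(maximalRealSubfield F) F (IsCMField.complexConj F) 2 Jstar)) :
        ↥(finAdelic ↥(maximalRealSubfield F) F (IsCMField.complexConj F) 2 Jstar) ⧸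
          (Kc.1.1 : Subgroup ↥(finAdelic ↥(maximalRealSubfield F) F (IsCMField.complexConj F) 2 Jstar))))
    (x'' : AlgPoints (S.M.obj N'') Ω) :
    AlgPoints.map Tr (AlgPoints.map (S.M.map (homOfLE h')) x'') = AlgPoints.map Tr₀ (AlgPoints.map (S.M.map (homOfLE h₀)) x'') := by
  have hmem : r₀⁻¹ * r ∈ Kc.1.1 := QuotientGroup.eq.1 hcoset.symm
  have h₁ : S.IsHeckeTranslate N'' Kc (1 * r) (S.M.map (homOfLE h') ≫ Tr) :=
    S.isHeckeTranslate_comp (S.isHeckeTranslate_one_map (homOfLE h')) hr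
  have h₂ : S.IsHeckeTranslate N'' Kc (1 * r₀ * (r₀⁻¹ * r)) ((S.M.map (homOfLE h₀) ≫ Tr₀) ≫ 𝟙 _) :=
    S.isHeckeTranslate_comp (S.isHeckeTranslate_comp (S.isHeckeTranslate_one_map (homOfLE h₀)) hr₀)
      (S.isHeckeTranslate_id_of_mem Kc hmem)
  rw [one_mul] at h₁
  rw [one_mul, mul_inv_cancel_left, Category.comp_id] at h₂
  rw [← AlgPoints.map_comp_apply, ← AlgPoints.map_comp_apply, S.heckeTranslate_unique h₁ h₂]

/-! ### §2 Fibre transitivity: two lifts of a point at a normal level differ by a translate -/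

/-- **FIBRE TRANSITIVITY — two lifts `x₀, x₀′ ∈ M⋆_{N₀}(Ω)` of the same point of `M⋆_{Kc}` differ by a Hecke translate `T_{k⁻¹}`, `k ∈ Kc`**
(`N₀ ≤ Kc` normalised by `Kc`, `hLQ` a level-quotient record, `Ω ⊇ F` algebraically closed): `Kc` acts on `M⋆_{N₀}` by automorphisms `act k` that are
translates by `k⁻¹` and `u : M⋆_{N₀} → M⋆_{Kc}` is the quotient by them for separated test objects ([Deligne1979ShimuraVarieties] 2.7.1 (b)–(c)), so the
geometric fibres of `u` are single `Kc`-orbits ([SGA1] V Prop. 1.1: ★ `IsSepQuotient.exists_map_act_eq_of_map_eq_geometric_of_finiteIndex`, `M⋆_{N₀}`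
projective, `N₀` of finite index in `Kc` acting trivially). [cite: Deligne1979ShimuraVarieties, 2.7.1 (b)–(c)] [cite: SGA1, Exp. V §1 Prop. 1.1]
[cite: MumfordAV1970, §7 Thm. p. 66 (Remark)] -/
theorem RecordSystemGS.exists_isHeckeTranslate_map_eq_of_map_eq (hLQ : S.IsLevelQuotient) {Ω : Type} [Field Ω] [Algebra F Ω]
    [IsAlgClosed Ω] {N₀ Kc : C5.SmallLevel K₀} (hN₀Kc : N₀ ≤ Kc) (hn₀ : ∀ k ∈ Kc.1.1, C5.HeckeLE k N₀ N₀)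
    (x₀ x₀' : AlgPoints (S.M.obj N₀) Ω)
    (h : AlgPoints.map (S.M.map (homOfLE hN₀Kc)) x₀ = AlgPoints.map (S.M.map (homOfLE hN₀Kc)) x₀') :
    ∃ k ∈ Kc.1.1, ∃ Tk : S.M.obj N₀ ⟶ S.M.obj N₀, S.IsHeckeTranslate N₀ N₀ k⁻¹ Tk ∧ AlgPoints.map Tk x₀ = x₀' := by
  obtain ⟨act, hact, hq⟩ := hLQ hN₀Kc (fun k hk n hn => hn₀ k hk n hn)
  haveI := C5.SmallLevel.normal_subgroupOf_of_heckeLE N₀ Kc hn₀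
  haveI := C5.SmallLevel.finiteIndex_subgroupOf N₀ Kc
  have hX : IsProjectiveOver (S.M.obj N₀) := S.projective N₀
  haveI : IsProper (S.M.obj Kc).hom := (S.projective Kc).isProper
  have hker : ∀ n ∈ (N₀.1.1 : Subgroup ↥(finAdelic ↥(maximalRealSubfield F) F (IsCMField.complexConj F) 2 Jstar)).subgroupOf Kc.1.1,
      act n = 1 := fun n hn =>
    RecordSystemGS.IsLevelQuotient.act_eq_one_of_mem hact n (Subgroup.mem_subgroupOf.1 hn)
  obtain ⟨k, hk⟩ := IsSepQuotient.exists_map_act_eq_of_map_eq_geometric_of_finiteIndex (algebraMap F Ω) act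
    ((N₀.1.1 : Subgroup ↥(finAdelic ↥(maximalRealSubfield F) F (IsCMField.complexConj F) 2 Jstar)).subgroupOf Kc.1.1)
    (S.M.map (homOfLE hN₀Kc)) hX inferInstance hker hq (P := x₀) (P' := x₀') h
  exact ⟨(k : ↥(finAdelic ↥(maximalRealSubfield F) F (IsCMField.complexConj F) 2 Jstar)), k.2, (act k).hom, hact k, hk⟩

/-! ### §3 The clause at one lift of `y` gives the clause at every lift of `y` -/

/-- **LIFT-INDEPENDENCE AT A NORMAL LEVEL — `hecke_at_lift_of_hecke_at_lift`.**  Let `S` be a level-quotient curve record (`hLQ`), `Kc` a small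
level, `t₁ t₂ ∈ G(𝔸_{F⁺,f})`, `T r N′ h : M⋆_{N′} → M⋆_{Kc}` ANY family of Hecke translates by `r` (`hT`; e.g. the record՚s chosen translates),
`Line`, `quotΩ`, `translΩ` ANY carriers on `M⋆_{Kc}(Ω)` (`Ω ⊇ F` algebraically closed), `N₀ ≤ Kc` normalised by `Kc` (`hn₀`) and `rd₁`, `rd₂` representative
systems of `Kc·t₁Kc ⁄ Kc`, `Kc·t₂Kc ⁄ Kc` admissible at `N₀`.  If `x₀, x₀′ ∈ M⋆_{N₀}(Ω)` both lie over `y` and the (c1) clause holds at `x₀` — a bijection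
`e : Kc·t₁Kc ⁄ Kc ≃ Line y` with `T_{rd₁ β} x₀ = quotΩ y (e β)` and `T_{rd₂ β₂} x₀ = translΩ y` — then it holds at `x₀′`, with `e′ := e ∘ (k⁻¹ • ·)` where
`x₀′ = T_{k⁻¹} x₀` (§2) and `T_{rd β} (T_{k⁻¹} x₀) = T_{rd (k⁻¹•β)} x₀` (§1).
[cite: Deligne1979ShimuraVarieties, 2.7.1 (b)–(c)] [cite: SGA1, Exp. V §1 Prop. 1.1] [cite: Milne2005ShimuraVarieties, §5 p. 58 L6–11, Rem. 5.29 (c) p. 65, Thm. 13.6 p. 118] -/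
theorem RecordSystemGS.hecke_at_lift_of_hecke_at_lift (hLQ : S.IsLevelQuotient) {Ω : Type} [Field Ω] [Algebra F Ω] [IsAlgClosed Ω]
    (Kc : C5.SmallLevel K₀) (t₁ t₂ : ↥(finAdelic ↥(maximalRealSubfield F) F (IsCMField.complexConj F) 2 Jstar))
    (T : ∀ (r : ↥(finAdelic ↥(maximalRealSubfield F) F (IsCMField.complexConj F) 2 Jstar)) (N' : C5.SmallLevel K₀), C5.HeckeLE r N' Kc → (S.M.obj N' ⟶ S.M.obj Kc))
    (hT : ∀ (r : ↥(finAdelic ↥(maximalRealSubfield F) F (IsCMField.complexConj F) 2 Jstar)) (N' : C5.SmallLevel K₀) (h : C5.HeckeLE r N' Kc), S.IsHeckeTranslate N' Kc r (T r N' h))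
    {Line : AlgPoints (S.M.obj Kc) Ω → Type*}
    (quotΩ : ∀ y, Line y → AlgPoints (S.M.obj Kc) Ω) (translΩ : AlgPoints (S.M.obj Kc) Ω → AlgPoints (S.M.obj Kc) Ω)
    (N₀ : C5.SmallLevel K₀) (hN₀Kc : N₀ ≤ Kc) (hn₀ : ∀ k ∈ Kc.1.1, C5.HeckeLE k N₀ N₀)
    (rd₁ : orbit (Kc.1.1 : Subgroup ↥(finAdelic ↥(maximalRealSubfield F) F (IsCMField.complexConj F) 2 Jstar))
         ((t₁ : ↥(finAdelic ↥(maximalRealSubfield F) F (IsCMField.complexConj F) 2 Jstar)) :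
           ↥(finAdelic ↥(maximalRealSubfield F) F (IsCMField.complexConj F) 2 Jstar) ⧸
             (Kc.1.1 : Subgroup ↥(finAdelic ↥(maximalRealSubfield F) F (IsCMField.complexConj F) 2 Jstar))) →
       ↥(finAdelic ↥(maximalRealSubfield F) F (IsCMField.complexConj F) 2 Jstar))
    (hrd₁ : ∀ β, ((rd₁ β : ↥(finAdelic ↥(maximalRealSubfield F) F (IsCMField.complexConj F) 2 Jstar)) :
        ↥(finAdelic ↥(maximalRealSubfield F) F (IsCMField.complexConj F) 2 Jstar) ⧸
          (Kc.1.1 : Subgroup ↥(finAdelic ↥(maximalRealSubfield F) F (IsCMField.complexConj F) 2 Jstar))) = β.1)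
    (hrdN₁ : ∀ β, C5.HeckeLE (rd₁ β) N₀ Kc)
    (rd₂ : orbit (Kc.1.1 : Subgroup ↥(finAdelic ↥(maximalRealSubfield F) F (IsCMField.complexConj F) 2 Jstar))
         ((t₂ : ↥(finAdelic ↥(maximalRealSubfield F) F (IsCMField.complexConj F) 2 Jstar)) :
           ↥(finAdelic ↥(maximalRealSubfield F) F (IsCMField.complexConj F) 2 Jstar) ⧸
             (Kc.1.1 : Subgroup ↥(finAdelic ↥(maximalRealSubfield F) F (IsCMField.complexConj F) 2 Jstar))) →
       ↥(finAdelic ↥(maximalRealSubfield F) F (IsCMField.complexConj F) 2 Jstar))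
    (hrd₂ : ∀ β, ((rd₂ β : ↥(finAdelic ↥(maximalRealSubfield F) F (IsCMField.complexConj F) 2 Jstar)) :
        ↥(finAdelic ↥(maximalRealSubfield F) F (IsCMField.complexConj F) 2 Jstar) ⧸
          (Kc.1.1 : Subgroup ↥(finAdelic ↥(maximalRealSubfield F) F (IsCMField.complexConj F) 2 Jstar))) = β.1)
    (hrdN₂ : ∀ β, C5.HeckeLE (rd₂ β) N₀ Kc)
    (x₀ x₀' : AlgPoints (S.M.obj N₀) Ω) (y : AlgPoints (S.M.obj Kc) Ω)
    (hx₀ : AlgPoints.map (S.M.map (homOfLE hN₀Kc)) x₀ = y) (hx₀' : AlgPoints.map (S.M.map (homOfLE hN₀Kc)) x₀' = y)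
    (h₀ : ∃ e : (orbit (Kc.1.1 : Subgroup ↥(finAdelic ↥(maximalRealSubfield F) F (IsCMField.complexConj F) 2 Jstar))
         ((t₁ : ↥(finAdelic ↥(maximalRealSubfield F) F (IsCMField.complexConj F) 2 Jstar)) :
           ↥(finAdelic ↥(maximalRealSubfield F) F (IsCMField.complexConj F) 2 Jstar) ⧸
             (Kc.1.1 : Subgroup ↥(finAdelic ↥(maximalRealSubfield F) F (IsCMField.complexConj F) 2 Jstar)))) ≃ Line y,
      (∀ β, AlgPoints.map (T (rd₁ β) N₀ (hrdN₁ β)) x₀ = quotΩ y (e β)) ∧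
        ∀ β₂, AlgPoints.map (T (rd₂ β₂) N₀ (hrdN₂ β₂)) x₀ = translΩ y) :
    ∃ e' : (orbit (Kc.1.1 : Subgroup ↥(finAdelic ↥(maximalRealSubfield F) F (IsCMField.complexConj F) 2 Jstar))
         ((t₁ : ↥(finAdelic ↥(maximalRealSubfield F) F (IsCMField.complexConj F) 2 Jstar)) :
           ↥(finAdelic ↥(maximalRealSubfield F) F (IsCMField.complexConj F) 2 Jstar) ⧸
             (Kc.1.1 : Subgroup ↥(finAdelic ↥(maximalRealSubfield F) F (IsCMField.complexConj F) 2 Jstar)))) ≃ Line y,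
      (∀ β, AlgPoints.map (T (rd₁ β) N₀ (hrdN₁ β)) x₀' = quotΩ y (e' β)) ∧
        ∀ β₂, AlgPoints.map (T (rd₂ β₂) N₀ (hrdN₂ β₂)) x₀' = translΩ y := by
  -- §2: the two lifts differ by a translate `Tk` by `k⁻¹`, `k ∈ Kc`
  obtain ⟨k, hk, Tk, hTk, hx⟩ := S.exists_isHeckeTranslate_map_eq_of_map_eq hLQ hN₀Kc hn₀ x₀ x₀' (hx₀.trans hx₀'.symm)
  subst hx
  obtain ⟨e, he₁, he₂⟩ := h₀
  -- representatives: `k⁻¹ · rd β` and `rd (k⁻¹ • β)` lie in the same `Kc`-coset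
  have hcoset₁ : ∀ β : orbit (Kc.1.1 : Subgroup ↥(finAdelic ↥(maximalRealSubfield F) F (IsCMField.complexConj F) 2 Jstar))
         ((t₁ : ↥(finAdelic ↥(maximalRealSubfield F) F (IsCMField.complexConj F) 2 Jstar)) :
           ↥(finAdelic ↥(maximalRealSubfield F) F (IsCMField.complexConj F) 2 Jstar) ⧸
             (Kc.1.1 : Subgroup ↥(finAdelic ↥(maximalRealSubfield F) F (IsCMField.complexConj F) 2 Jstar))),
      ((k⁻¹ * rd₁ β : ↥(finAdelic ↥(maximalRealSubfield F) F (IsCMField.complexConj F) 2 Jstar)) :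
        ↥(finAdelic ↥(maximalRealSubfield F) F (IsCMField.complexConj F) 2 Jstar) ⧸
          (Kc.1.1 : Subgroup ↥(finAdelic ↥(maximalRealSubfield F) F (IsCMField.complexConj F) 2 Jstar))) =
      ((rd₁ ((⟨k, hk⟩ : ↥(Kc.1.1 : Subgroup ↥(finAdelic ↥(maximalRealSubfield F) F (IsCMField.complexConj F) 2 Jstar)))⁻¹ • β) :
          ↥(finAdelic ↥(maximalRealSubfield F) F (IsCMField.complexConj F) 2 Jstar)) :
        ↥(finAdelic ↥(maximalRealSubfield F) F (IsCMField.complexConj F) 2 Jstar) ⧸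
          (Kc.1.1 : Subgroup ↥(finAdelic ↥(maximalRealSubfield F) F (IsCMField.complexConj F) 2 Jstar))) := fun β => by
    rw [hrd₁ _, orbit.coe_smul, ← hrd₁ β]
    rfl
  have hcoset₂ : ∀ β : orbit (Kc.1.1 : Subgroup ↥(finAdelic ↥(maximalRealSubfield F) F (IsCMField.complexConj F) 2 Jstar))
         ((t₂ : ↥(finAdelic ↥(maximalRealSubfield F) F (IsCMField.complexConj F) 2 Jstar)) :
           ↥(finAdelic ↥(maximalRealSubfield F) F (IsCMField.complexConj F) 2 Jstar) ⧸
             (Kc.1.1 : Subgroup ↥(finAdelic ↥(maximalRealSubfield F) F (IsCMField.complexConj F) 2 Jstar))),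
      ((k⁻¹ * rd₂ β : ↥(finAdelic ↥(maximalRealSubfield F) F (IsCMField.complexConj F) 2 Jstar)) :
        ↥(finAdelic ↥(maximalRealSubfield F) F (IsCMField.complexConj F) 2 Jstar) ⧸
          (Kc.1.1 : Subgroup ↥(finAdelic ↥(maximalRealSubfield F) F (IsCMField.complexConj F) 2 Jstar))) =
      ((rd₂ ((⟨k, hk⟩ : ↥(Kc.1.1 : Subgroup ↥(finAdelic ↥(maximalRealSubfield F) F (IsCMField.complexConj F) 2 Jstar)))⁻¹ • β) :
          ↥(finAdelic ↥(maximalRealSubfield F) F (IsCMField.complexConj F) 2 Jstar)) :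
        ↥(finAdelic ↥(maximalRealSubfield F) F (IsCMField.complexConj F) 2 Jstar) ⧸
          (Kc.1.1 : Subgroup ↥(finAdelic ↥(maximalRealSubfield F) F (IsCMField.complexConj F) 2 Jstar))) := fun β => by
    rw [hrd₂ _, orbit.coe_smul, ← hrd₂ β]
    rfl
  refine ⟨(MulAction.toPerm ((⟨k, hk⟩ : ↥(Kc.1.1 : Subgroup ↥(finAdelic ↥(maximalRealSubfield F) F (IsCMField.complexConj F) 2 Jstar)))⁻¹)).trans e,
    fun β => ?_, fun β₂ => ?_⟩
  · exact (S.map_map_eq_of_isHeckeTranslate_of_coset_eq hTk (hT _ _ (hrdN₁ β)) (hT _ _ (hrdN₁ _)) (hcoset₁ β) x₀).trans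
      (he₁ _)
  · exact (S.map_map_eq_of_isHeckeTranslate_of_coset_eq hTk (hT _ _ (hrdN₂ β₂)) (hT _ _ (hrdN₂ _)) (hcoset₂ β₂) x₀).trans
      (he₂ _)

/-! ### §4 The head: (c1) at every presentation from (c1) at one chosen lift per point -/

set_option maxHeartbeats 400000 in -- large adelic ∕ Shimura-set binder types (as ★ `AppendixC.hecke_of_hecke_at_level`)
/-- **HECKE-PRESENTATION FROM CHOSEN LIFTS — `hecke_of_hecke_at_chosen_lifts`.**  Let `S` be a level-quotient curve record (`hLQ`; ★
`RecordSystemGS.isLevelQuotient_of_heckeTranslateDefinedOver`), `Kc` a small level, `t₁ t₂ ∈ G(𝔸_{F⁺,f})`, `T r N′ h : M⋆_{N′} → M⋆_{Kc}` ANY family of Hecke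
translates by `r` for `r` admissible at `N′` (`hT`), and `Line`, `quotΩ`, `translΩ` ANY carriers on `M⋆_{Kc}(Ω)` (`Ω ⊇ F` algebraically closed).  Fix a
reference level `N₀ ≤ Kc` NORMALISED by `Kc` (`hn₀`; ★ `C5.SmallLevel.exists_normal_le_forall_heckeLE`) with representative systems `rd₁`, `rd₂` of
`Kc·t₁Kc ⁄ Kc`, `Kc·t₂Kc ⁄ Kc` admissible at `N₀`.  If EVERY `y ∈ M⋆_{Kc}(Ω)` has SOME lift `x₀ ∈ M⋆_{N₀}(Ω)` at which the (c1) clause holds (`h₀`: a bijection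
`e : Kc·t₁Kc ⁄ Kc ≃ Line y` with `T_{rd₁ β} x₀ = quotΩ y (e β)`, `T_{rd₂ β₂} x₀ = translΩ y`), then the clause holds at EVERY presentation
`(N′, rc₁, rc₂, x′)` — conclusion spelled exactly as the field `ModuliDatum.hecke` ∕ `PointDictionary.hecke` ∕ the D-line letter `HeckeClause` (binders
`N′ hN′Kc rc₁ _ hrcN₁ rc₂ _ hrcN₂ x′`) with `T (rc β) N′ (hrcN β)` for the translate.  Proof: module docstring (§0 common lift, §1, §3).
[cite: Milne2005ShimuraVarieties, §5 p. 57, Rem. 5.29 (c) p. 65, Thm. 13.6 p. 118] [cite: Deligne1979ShimuraVarieties, 2.7.1 (c)]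
[cite: SGA1, Exp. V §1 Prop. 1.1] [cite: Liu2021, §4.2 l. 2060–2074; Prop. D.8 (1) p. 135] -/
theorem RecordSystemGS.hecke_of_hecke_at_chosen_lifts (hLQ : S.IsLevelQuotient) {Ω : Type} [Field Ω] [Algebra F Ω] [IsAlgClosed Ω]
    (Kc : C5.SmallLevel K₀) (t₁ t₂ : ↥(finAdelic ↥(maximalRealSubfield F) F (IsCMField.complexConj F) 2 Jstar))
    (T : ∀ (r : ↥(finAdelic ↥(maximalRealSubfield F) F (IsCMField.complexConj F) 2 Jstar)) (N' : C5.SmallLevel K₀), C5.HeckeLE r N' Kc → (S.M.obj N' ⟶ S.M.obj Kc))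
    (hT : ∀ (r : ↥(finAdelic ↥(maximalRealSubfield F) F (IsCMField.complexConj F) 2 Jstar)) (N' : C5.SmallLevel K₀) (h : C5.HeckeLE r N' Kc), S.IsHeckeTranslate N' Kc r (T r N' h))
    {Line : AlgPoints (S.M.obj Kc) Ω → Type*}
    (quotΩ : ∀ y, Line y → AlgPoints (S.M.obj Kc) Ω) (translΩ : AlgPoints (S.M.obj Kc) Ω → AlgPoints (S.M.obj Kc) Ω)
    (N₀ : C5.SmallLevel K₀) (hN₀Kc : N₀ ≤ Kc) (hn₀ : ∀ k ∈ Kc.1.1, C5.HeckeLE k N₀ N₀)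
    (rd₁ : orbit (Kc.1.1 : Subgroup ↥(finAdelic ↥(maximalRealSubfield F) F (IsCMField.complexConj F) 2 Jstar))
         ((t₁ : ↥(finAdelic ↥(maximalRealSubfield F) F (IsCMField.complexConj F) 2 Jstar)) :
           ↥(finAdelic ↥(maximalRealSubfield F) F (IsCMField.complexConj F) 2 Jstar) ⧸
             (Kc.1.1 : Subgroup ↥(finAdelic ↥(maximalRealSubfield F) F (IsCMField.complexConj F) 2 Jstar))) →
       ↥(finAdelic ↥(maximalRealSubfield F) F (IsCMField.complexConj F) 2 Jstar))
    (hrd₁ : ∀ β, ((rd₁ β : ↥(finAdelic ↥(maximalRealSubfield F) F (IsCMField.complexConj F) 2 Jstar)) :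
        ↥(finAdelic ↥(maximalRealSubfield F) F (IsCMField.complexConj F) 2 Jstar) ⧸
          (Kc.1.1 : Subgroup ↥(finAdelic ↥(maximalRealSubfield F) F (IsCMField.complexConj F) 2 Jstar))) = β.1)
    (hrdN₁ : ∀ β, C5.HeckeLE (rd₁ β) N₀ Kc)
    (rd₂ : orbit (Kc.1.1 : Subgroup ↥(finAdelic ↥(maximalRealSubfield F) F (IsCMField.complexConj F) 2 Jstar))
         ((t₂ : ↥(finAdelic ↥(maximalRealSubfield F) F (IsCMField.complexConj F) 2 Jstar)) :
           ↥(finAdelic ↥(maximalRealSubfield F) F (IsCMField.complexConj F) 2 Jstar) ⧸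
             (Kc.1.1 : Subgroup ↥(finAdelic ↥(maximalRealSubfield F) F (IsCMField.complexConj F) 2 Jstar))) →
       ↥(finAdelic ↥(maximalRealSubfield F) F (IsCMField.complexConj F) 2 Jstar))
    (hrd₂ : ∀ β, ((rd₂ β : ↥(finAdelic ↥(maximalRealSubfield F) F (IsCMField.complexConj F) 2 Jstar)) :
        ↥(finAdelic ↥(maximalRealSubfield F) F (IsCMField.complexConj F) 2 Jstar) ⧸
          (Kc.1.1 : Subgroup ↥(finAdelic ↥(maximalRealSubfield F) F (IsCMField.complexConj F) 2 Jstar))) = β.1)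
    (hrdN₂ : ∀ β, C5.HeckeLE (rd₂ β) N₀ Kc)
    (h₀ : ∀ y : AlgPoints (S.M.obj Kc) Ω, ∃ x₀ : AlgPoints (S.M.obj N₀) Ω,
      AlgPoints.map (S.M.map (homOfLE hN₀Kc)) x₀ = y ∧
      ∃ e : (orbit (Kc.1.1 : Subgroup ↥(finAdelic ↥(maximalRealSubfield F) F (IsCMField.complexConj F) 2 Jstar))
         ((t₁ : ↥(finAdelic ↥(maximalRealSubfield F) F (IsCMField.complexConj F) 2 Jstar)) :
           ↥(finAdelic ↥(maximalRealSubfield F) F (IsCMField.complexConj F) 2 Jstar) ⧸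
             (Kc.1.1 : Subgroup ↥(finAdelic ↥(maximalRealSubfield F) F (IsCMField.complexConj F) 2 Jstar)))) ≃ Line y,
      (∀ β, AlgPoints.map (T (rd₁ β) N₀ (hrdN₁ β)) x₀ = quotΩ y (e β)) ∧
        ∀ β₂, AlgPoints.map (T (rd₂ β₂) N₀ (hrdN₂ β₂)) x₀ = translΩ y)
    (N' : C5.SmallLevel K₀) (hN'Kc : N' ≤ Kc)
    (rc₁ : orbit (Kc.1.1 : Subgroup ↥(finAdelic ↥(maximalRealSubfield F) F (IsCMField.complexConj F) 2 Jstar))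
         ((t₁ : ↥(finAdelic ↥(maximalRealSubfield F) F (IsCMField.complexConj F) 2 Jstar)) :
           ↥(finAdelic ↥(maximalRealSubfield F) F (IsCMField.complexConj F) 2 Jstar) ⧸
             (Kc.1.1 : Subgroup ↥(finAdelic ↥(maximalRealSubfield F) F (IsCMField.complexConj F) 2 Jstar))) →
       ↥(finAdelic ↥(maximalRealSubfield F) F (IsCMField.complexConj F) 2 Jstar))
    (hrc₁ : ∀ β, ((rc₁ β : ↥(finAdelic ↥(maximalRealSubfield F) F (IsCMField.complexConj F) 2 Jstar)) :
        ↥(finAdelic ↥(maximalRealSubfield F) F (IsCMField.complexConj F) 2 Jstar) ⧸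
          (Kc.1.1 : Subgroup ↥(finAdelic ↥(maximalRealSubfield F) F (IsCMField.complexConj F) 2 Jstar))) = β.1)
    (hrcN₁ : ∀ β, C5.HeckeLE (rc₁ β) N' Kc)
    (rc₂ : orbit (Kc.1.1 : Subgroup ↥(finAdelic ↥(maximalRealSubfield F) F (IsCMField.complexConj F) 2 Jstar))
         ((t₂ : ↥(finAdelic ↥(maximalRealSubfield F) F (IsCMField.complexConj F) 2 Jstar)) :
           ↥(finAdelic ↥(maximalRealSubfield F) F (IsCMField.complexConj F) 2 Jstar) ⧸
             (Kc.1.1 : Subgroup ↥(finAdelic ↥(maximalRealSubfield F) F (IsCMField.complexConj F) 2 Jstar))) →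
       ↥(finAdelic ↥(maximalRealSubfield F) F (IsCMField.complexConj F) 2 Jstar))
    (hrc₂ : ∀ β, ((rc₂ β : ↥(finAdelic ↥(maximalRealSubfield F) F (IsCMField.complexConj F) 2 Jstar)) :
        ↥(finAdelic ↥(maximalRealSubfield F) F (IsCMField.complexConj F) 2 Jstar) ⧸
          (Kc.1.1 : Subgroup ↥(finAdelic ↥(maximalRealSubfield F) F (IsCMField.complexConj F) 2 Jstar))) = β.1)
    (hrcN₂ : ∀ β, C5.HeckeLE (rc₂ β) N' Kc)
    (x' : AlgPoints (S.M.obj N') Ω) :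
    ∃ e : (orbit (Kc.1.1 : Subgroup ↥(finAdelic ↥(maximalRealSubfield F) F (IsCMField.complexConj F) 2 Jstar))
         ((t₁ : ↥(finAdelic ↥(maximalRealSubfield F) F (IsCMField.complexConj F) 2 Jstar)) :
           ↥(finAdelic ↥(maximalRealSubfield F) F (IsCMField.complexConj F) 2 Jstar) ⧸
             (Kc.1.1 : Subgroup ↥(finAdelic ↥(maximalRealSubfield F) F (IsCMField.complexConj F) 2 Jstar)))) ≃ Line (AlgPoints.map (S.M.map (homOfLE hN'Kc)) x'),
      (∀ β, AlgPoints.map (T (rc₁ β) N' (hrcN₁ β)) x' = quotΩ (AlgPoints.map (S.M.map (homOfLE hN'Kc)) x') (e β)) ∧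
        ∀ β₂, AlgPoints.map (T (rc₂ β₂) N' (hrcN₂ β₂)) x' = translΩ (AlgPoints.map (S.M.map (homOfLE hN'Kc)) x') := by
  -- a common level `N″ ≤ N′ ⊓ N₀`
  obtain ⟨N'', hN''N', hN''N₀⟩ := C5.SmallLevel.exists_le_le N' N₀
  -- lift `x′` to `x″ ∈ M⋆_{N″}(Ω)`; `x₀′ := u_{N″→N₀} x″` lies over the same `y`
  obtain ⟨x'', hx''⟩ := S.exists_algPoints_map_eq_of_isLevelQuotient hLQ hN''N' x'
  subst hx''
  have hy : AlgPoints.map (S.M.map (homOfLE hN₀Kc)) (AlgPoints.map (S.M.map (homOfLE hN''N₀)) x'') =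
      AlgPoints.map (S.M.map (homOfLE hN'Kc)) (AlgPoints.map (S.M.map (homOfLE hN''N')) x'') := by
    rw [← AlgPoints.map_comp_apply, ← AlgPoints.map_comp_apply, ← Functor.map_comp, ← Functor.map_comp]
    rfl
  -- the clause at the chosen lift of `y`, moved to the lift `x₀′` (§3), then to `x′` (§1)
  obtain ⟨x₀, hx₀, h₀y⟩ := h₀ (AlgPoints.map (S.M.map (homOfLE hN'Kc)) (AlgPoints.map (S.M.map (homOfLE hN''N')) x''))
  have h₃ := S.hecke_at_lift_of_hecke_at_lift hLQ Kc t₁ t₂ T hT quotΩ translΩ N₀ hN₀Kc hn₀ rd₁ hrd₁ hrdN₁ rd₂ hrd₂ hrdN₂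
    x₀ (AlgPoints.map (S.M.map (homOfLE hN''N₀)) x'')
    (AlgPoints.map (S.M.map (homOfLE hN'Kc)) (AlgPoints.map (S.M.map (homOfLE hN''N')) x'')) hx₀ hy h₀y
  obtain ⟨e, he₁, he₂⟩ := h₃
  refine ⟨e, fun β => ?_, fun β₂ => ?_⟩
  · exact (S.map_map_eq_map_map_of_isHeckeTranslate_of_coset_eq hN''N' hN''N₀ (hT _ _ (hrcN₁ β)) (hT _ _ (hrdN₁ β))
      ((hrc₁ β).trans (hrd₁ β).symm) x'').trans (he₁ β)
  · exact (S.map_map_eq_map_map_of_isHeckeTranslate_of_coset_eq hN''N' hN''N₀ (hT _ _ (hrcN₂ β₂)) (hT _ _ (hrdN₂ β₂))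
      ((hrc₂ β₂).trans (hrd₂ β₂).symm) x'').trans (he₂ β₂)

end Literature.AlgebraicGeometry.ShimuraVarieties.UnitaryCanonicalModel
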